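import Literature.Topology.FourManifolds.TrisectionsHandlebodies
import HarnessLib

/-!
# Assembly skeleton: the three sectors of the handle-decomposition construction form a
# Gay–Kirby trisection, modulo the remaining Morse-theoretic inputs (Gay–Kirby 2016, Lemma 14)

Topic `Literature/Topology/FourManifolds`; for the fact seat
`provefact-Literature.Topology.FourManifolds.exists_isBalancedGKTrisection` (Gay–Kirby 2016,
Thm. 4 via Lemma 14).  Everything in this file is **proved**; no named facts are introduced.

This file assembles the clauses of the corrected trisection predicate
`Literature.Topology.FourManifolds.IsGKTrisection` for the sectors
`![X₁, X₂, X₃]` of `Literature.Topology.FourManifolds.BiCollar.TriData` (`TriData.sectors`) from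
the geometric results of `TrisectionsBevelledSector.lean`, `TrisectionsMiddleSectors.lean`,
`TrisectionsMiddleCharts.lean` and `TrisectionsHandlebodies.lean`, isolating as **explicit
hypotheses** exactly what is still to be supplied by Morse theory:

* clause (i) — the cover — is `TriData.iUnion_eq_univ` (no hypothesis);
* clause (ii) for each sector (`clause_ii_X₁`, `clause_ii_X₂`, `clause_ii_X₃`): the sector with
  its straightened structure (`BevelData.cornerSliceAtlas`, `TriData.cornerSliceAtlas₂/₃`) is the
  witness `W`, embedded by the inclusion, a `C^∞` immersion off `F` with corner charts along
  `F = ⋂ X_i` (`iInter_eq_surface`), compact, with the mutual intersections in the image of its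
  boundary — all proved —; the **hypotheses** are its connectedness and its handle decomposition
  `HasHandleDecomposition 3 · (handleCount 1 kᵢ)` (Gay–Kirby: "`X₁` and `X₃` are both
  `♮ᵏ S¹ × B³` … there is some series of handle slides and cancellations showing `X₂` is
  diffeomorphic to `♮ᵏ S¹ × B³`");
* clause (iii) (`clause_iii`): for the pairs `(X₁, X₂)`, `(X₃, X₁)` it is
  `TriData.exists_H₁₂`, `TriData.exists_H₃₁` under the Morse data of the Heegaard function `g`
  below/above `b`; for the pair `(X₂, X₃)` the handlebody `H₂₃` is a **hypothesis**;
* `TriData.isGKTrisection_of` — the conjunction.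

## References

* D. Gay, R. Kirby, *Trisecting 4-manifolds*, Geom. Topol. 20 (2016) 3097–3132
  (arXiv:1205.1565): Def. 1; §4, Lemma 14 and its proof; Thm. 4. [GayKirby2016]
-/

open scoped Manifold ContDiff Topology
open Set Function Filter

noncomputable section

universe u

namespace Literature.Topology.FourManifolds

variable {X : Type u} [TopologicalSpace X] [T2Space X] [CompactSpace X]
  [ChartedSpace (EuclideanSpace ℝ (Fin 4)) X] [IsManifold (𝓡 4) ∞ X]

namespace BiCollar

namespace TriData

variable {B : BiCollar X} (T : B.TriData)

/-- **The three sectors** `![X₁, X₂, X₃]`. [cite: GayKirby2016, §4, Lemma 14] -/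
def sectors : Fin 3 → Set X := ![T.X₁, T.X₂, T.X₃]

/-- `sectors 0 = X₁`. [folklore] -/
@[simp] theorem sectors_zero : T.sectors 0 = T.X₁ := rfl

/-- `sectors 1 = X₂`. [folklore] -/
@[simp] theorem sectors_one : T.sectors 1 = T.X₂ := rfl

/-- `sectors 2 = X₃`. [folklore] -/
@[simp] theorem sectors_two : T.sectors 2 = T.X₃ := rfl

/-- The triple intersection of the sectors is the central surface. [cite: GayKirby2016, Def. 1] -/
theorem iInter_sectors (hc2 : B.a + B.U.δ + 2 * T.ε ≤ T.c) : (⋂ l, T.sectors l) = B.surface :=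
  T.iInter_eq_surface hc2

/-- Clause (i): the sectors cover `X`. [cite: GayKirby2016, Def. 1] -/
theorem iUnion_sectors : (⋃ i, T.sectors i) = univ := T.iUnion_eq_univ

section Clauses

variable (hc2 : B.a + B.U.δ + 2 * T.ε ≤ T.c) {η : ℝ} (hη : 2 * T.ε ≤ η)
  (hL : ∀ q : X, IsMCriticalPt (𝓡 4) B.f q → B.a < B.f q → B.f q ≤ T.c →
    ∀ y : B.Y, RegularLevel.incl B.hf y ∈ stableSet (𝓡 4) B.U.ξ q → B.g y < B.b - η)

/-- The shape of clause (ii) of `IsGKTrisection` for the sector `i`. [cite: GayKirby2016, Def. 1] -/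
def ClauseII (i : Fin 3) (k : ℕ) : Prop :=
  ∃ (W : Type u) (_ : TopologicalSpace W) (_ : ChartedSpace (EuclideanHalfSpace 4) W)
    (e : W → X), IsManifold (𝓡∂ 4) ∞ W ∧ CompactSpace W ∧ ConnectedSpace W ∧
      HasHandleDecomposition 3 W (handleCount 1 k) ∧
      Topology.IsEmbedding e ∧ range e = T.sectors i ∧
      (∀ w, e w ∉ (⋂ l, T.sectors l) → Manifold.IsImmersionAt (𝓡∂ 4) (𝓡 4) ∞ e w) ∧
      (∀ w, e w ∈ (⋂ l, T.sectors l) → IsCornerAt e w) ∧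
      ∀ j, j ≠ i → T.sectors i ∩ T.sectors j ⊆ e '' (𝓡∂ 4).boundary W

include hc2 in
/-- **Clause (ii) for `X₁`**, given connectedness and the handle decomposition of the
straightened first sector. [cite: GayKirby2016, Def. 1 and §4, Lemma 14] -/
theorem clause_ii_X₁ {k₁ : ℕ}
    (h₁ : letI := T.D.cornerSliceAtlas.chartedSpace
      ConnectedSpace T.D.sector ∧ HasHandleDecomposition 3 T.D.sector (handleCount 1 k₁)) :
    T.ClauseII 0 k₁ := by
  letI := T.D.cornerSliceAtlas.chartedSpace
  obtain ⟨hM, hemb, hrange, himm, hcor, -⟩ := T.D.sector_smooth_clause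
  have hF : (⋂ l, T.sectors l) = B.surface := T.iInter_sectors hc2
  refine ⟨T.D.sector, inferInstance, inferInstance, Subtype.val, hM, T.D.compactSpace_sector, h₁.1, h₁.2, hemb,
    hrange, fun w hw => himm w (by rwa [hF] at hw), fun w hw => hcor w (by rwa [hF] at hw), fun j hj => ?_⟩
  have hb := T.inter_subset_image_boundary₁
  fin_cases j
  · exact absurd rfl hj
  · exact hb.1
  · exact hb.2

include hc2 hη hL in
/-- **Clause (ii) for `X₂`**, given connectedness and the handle decomposition of the
straightened second sector. [cite: GayKirby2016, Def. 1 and §4, Lemma 14] -/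
theorem clause_ii_X₂ {k₂ : ℕ}
    (h₂ : letI := (T.cornerSliceAtlas₂ hc2 hη hL).chartedSpace
      ConnectedSpace T.X₂ ∧ HasHandleDecomposition 3 T.X₂ (handleCount 1 k₂)) :
    T.ClauseII 1 k₂ := by
  letI := (T.cornerSliceAtlas₂ hc2 hη hL).chartedSpace
  obtain ⟨hM, hemb, hrange, himm, hcor, -⟩ := T.sector_smooth_clause₂ hc2 hη hL
  have hF : (⋂ l, T.sectors l) = B.surface := T.iInter_sectors hc2
  refine ⟨T.X₂, inferInstance, inferInstance, Subtype.val, hM, T.compactSpace_X₂, h₂.1, h₂.2, hemb,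
    hrange, fun w hw => himm w (by rwa [hF] at hw), fun w hw => hcor w (by rwa [hF] at hw), fun j hj => ?_⟩
  have hb := T.inter_subset_image_boundary₂ hc2 hη hL
  fin_cases j
  · exact hb.1
  · exact absurd rfl hj
  · exact hb.2

include hc2 hη hL in
/-- **Clause (ii) for `X₃`**, given connectedness and the handle decomposition of the
straightened third sector. [cite: GayKirby2016, Def. 1 and §4, Lemma 14] -/
theorem clause_ii_X₃ {k₃ : ℕ}
    (h₃ : letI := (T.cornerSliceAtlas₃ hc2 hη hL).chartedSpace
      ConnectedSpace T.X₃ ∧ HasHandleDecomposition 3 T.X₃ (handleCount 1 k₃)) :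
    T.ClauseII 2 k₃ := by
  letI := (T.cornerSliceAtlas₃ hc2 hη hL).chartedSpace
  obtain ⟨hM, hemb, hrange, himm, hcor, -⟩ := T.sector_smooth_clause₃ hc2 hη hL
  have hF : (⋂ l, T.sectors l) = B.surface := T.iInter_sectors hc2
  refine ⟨T.X₃, inferInstance, inferInstance, Subtype.val, hM, T.compactSpace_X₃, h₃.1, h₃.2, hemb,
    hrange, fun w hw => himm w (by rwa [hF] at hw), fun w hw => hcor w (by rwa [hF] at hw), fun j hj => ?_⟩
  have hb := T.inter_subset_image_boundary₃ hc2 hη hL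
  fin_cases j
  · exact hb.1
  · exact hb.2
  · exact absurd rfl hj

/-- The shape of clause (iii) of `IsGKTrisection` for the pair `(i, j)`. [cite: GayKirby2016, Def. 1] -/
def ClauseIII (gen : ℕ) (i j : Fin 3) : Prop :=
  ∃ (H : Type u) (_ : TopologicalSpace H) (_ : ChartedSpace (EuclideanHalfSpace 3) H)
    (h : H → X), IsManifold (𝓡∂ 3) ∞ H ∧ CompactSpace H ∧ ConnectedSpace H ∧
      HasHandleDecomposition 2 H (handleCount 1 gen) ∧
      Manifold.IsSmoothEmbedding (𝓡∂ 3) (𝓡 4) ∞ h ∧ range h = T.sectors i ∩ T.sectors j ∧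
      h '' (𝓡∂ 3).boundary H = ⋂ l, T.sectors l

/-- Clause (iii) is symmetric in the pair. [folklore] -/
theorem clauseIII_symm {gen : ℕ} {i j : Fin 3} (h : T.ClauseIII gen i j) : T.ClauseIII gen j i := by
  obtain ⟨H, t, c, h, h1, h2, h3, h4, h5, h6, h7⟩ := h
  exact ⟨H, t, c, h, h1, h2, h3, h4, h5, by rw [h6, inter_comm], h7⟩

include hc2 in
/-- **Clause (iii)**, from `exists_H₁₂`, `exists_H₃₁` (Morse data of `g`) and the handlebody
`H₂₃` (hypothesis). [cite: GayKirby2016, Def. 1 and §4, Lemma 14] -/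
theorem clause_iii {gen : ℕ} (hgM : IsMorse (𝓡 3) B.g)
    (hcount₁₂ : ∀ i, (criticalSetOfIndex (𝓡 3) B.g i ∩ B.g ⁻¹' Iic B.b).ncard = handleCount 1 gen i)
    (h0 : (criticalSetOfIndex (𝓡 3) B.g 0).Subsingleton)
    (hcount₃₁ : ∀ i, (criticalSetOfIndex (𝓡 3) (fun y => B.b - B.g y) i ∩
      (fun y => B.b - B.g y) ⁻¹' Iic 0).ncard = handleCount 1 gen i)
    (htop : (criticalSetOfIndex (𝓡 3) B.g 3).Subsingleton)
    (hH₂₃ : T.ClauseIII gen 1 2) :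
    ∀ i j : Fin 3, i ≠ j → T.ClauseIII gen i j := by
  have hF : (⋂ l, T.sectors l) = B.surface := T.iInter_sectors hc2
  have h01 : T.ClauseIII gen 0 1 := by
    obtain ⟨H, t, c, h, h1, h2, h3, h4, h5, h6, h7⟩ := T.exists_H₁₂ hc2 hgM hcount₁₂ h0
    exact ⟨H, t, c, h, h1, h2, h3, h4, h5, h6, by rw [h7, hF]⟩
  have h20 : T.ClauseIII gen 2 0 := by
    obtain ⟨H, t, c, h, h1, h2, h3, h4, h5, h6, h7⟩ := T.exists_H₃₁ hc2 hgM hcount₃₁ htop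
    exact ⟨H, t, c, h, h1, h2, h3, h4, h5, h6, by rw [h7, hF]⟩
  intro i j hij
  fin_cases i <;> fin_cases j
  · exact absurd rfl hij
  · exact h01
  · exact T.clauseIII_symm h20
  · exact T.clauseIII_symm h01
  · exact absurd rfl hij
  · exact hH₂₃
  · exact h20
  · exact T.clauseIII_symm hH₂₃
  · exact absurd rfl hij

include hc2 hη hL in
/-- **The sectors form a Gay–Kirby trisection, modulo the Morse-theoretic inputs**: the handle
decompositions and connectedness of the three straightened sectors, the Morse data of the
Heegaard function `g` (for `H₁₂`, `H₃₁`) and the handlebody `H₂₃ = X₂ ∩ X₃`.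
[cite: GayKirby2016, Def. 1; §4, Lemma 14; Thm. 4] -/
theorem isGKTrisection_of {gen k₁ k₂ k₃ : ℕ}
    (h₁ : letI := T.D.cornerSliceAtlas.chartedSpace
      ConnectedSpace T.D.sector ∧ HasHandleDecomposition 3 T.D.sector (handleCount 1 k₁))
    (h₂ : letI := (T.cornerSliceAtlas₂ hc2 hη hL).chartedSpace
      ConnectedSpace T.X₂ ∧ HasHandleDecomposition 3 T.X₂ (handleCount 1 k₂))
    (h₃ : letI := (T.cornerSliceAtlas₃ hc2 hη hL).chartedSpace
      ConnectedSpace T.X₃ ∧ HasHandleDecomposition 3 T.X₃ (handleCount 1 k₃))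
    (hgM : IsMorse (𝓡 3) B.g)
    (hcount₁₂ : ∀ i, (criticalSetOfIndex (𝓡 3) B.g i ∩ B.g ⁻¹' Iic B.b).ncard = handleCount 1 gen i)
    (h0 : (criticalSetOfIndex (𝓡 3) B.g 0).Subsingleton)
    (hcount₃₁ : ∀ i, (criticalSetOfIndex (𝓡 3) (fun y => B.b - B.g y) i ∩
      (fun y => B.b - B.g y) ⁻¹' Iic 0).ncard = handleCount 1 gen i)
    (htop : (criticalSetOfIndex (𝓡 3) B.g 3).Subsingleton)
    (hH₂₃ : T.ClauseIII gen 1 2) :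
    IsGKTrisection X gen ![k₁, k₂, k₃] T.sectors := by
  refine ⟨T.iUnion_sectors, fun i => ?_, T.clause_iii hc2 hgM hcount₁₂ h0 hcount₃₁ htop hH₂₃⟩
  fin_cases i
  · exact T.clause_ii_X₁ hc2 h₁
  · exact T.clause_ii_X₂ hc2 hη hL h₂
  · exact T.clause_ii_X₃ hc2 hη hL h₃

end Clauses

end TriData

end BiCollar

end Literature.Topology.FourManifolds

end
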